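import Literature.MathematicalPhysics.QuantumManyBody.PeriodicHeatFlowSpectralProofs
import HarnessLib

/-!
# Crux `CorrectorClosure` (stmt-AtomisticToContinuum-12058), line `healing-scale-kac-insertion` —
# sub-goal `fkGroundState_translate_eq`: translation invariance of the torus Feynman–Kac ground
# state, and the vanishing mean of every density mode

Supports (does not close) stmt-AtomisticToContinuum-12058, route `BECInsertionCorrector`; a
registered sub-goal of the heart `stub_kacClosure` of the lead's skeleton
`Cruxes/CorrectorClosure/Lines/healing-scale-kac-insertion.lean`.

Let `Θ₀ : Config N → ℝ` be a witness of `IsPeriodicGroundStateFK v L` (the `N`-body torus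
Feynman–Kac ground state: nonnegative, periodic, Bose symmetric, cell-normalised, exact
eigenfunction of the periodic Feynman–Kac functional and its rank-one large-time limit). Then
`Θ₀ (X + (u, …, u)) = Θ₀ X` for every common translation `u ∈ ℝ³` of all particles.

Proof: the translate `Θ_u := Θ₀ (· + (u, …, u))` is AGAIN a witness of `IsPeriodicGroundStateFK v L`
— the periodic Feynman–Kac functional is covariant under common translations
(`periodicFKSemigroup_add_const`: the periodised pair action only sees differences of world-lines,
`periodicFKWeight_add_const`, and `worldLine (X + A) ω s = worldLine X ω s + A`), and cell
integrals of periodic functions are shift invariant (`lintegral_cellN_comp_add`) — so the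
uniqueness of witnesses (`IsPeriodicGroundStateFK.unique`: the projection limit of one witness
tested on the other) gives `Θ_u = Θ₀`. For the `tendsto` field of `Θ_u` at `(g, X)` one applies the
`tendsto` field of `Θ₀` to the back-translated observable `g (· - (u, …, u))` at the point
`X + (u, …, u)` and moves the translation from `g` onto `Θ₀` inside the cell pairing.

Corollary (what the heart consumes, no hypothesis on `v`): for `k ∈ ℤ³ ∖ {0}` the density modes
`∑ⱼ cos((2π/L) k·xⱼ)` and `∑ⱼ sin((2π/L) k·xⱼ)` have VANISHING MEAN against `Θ₀²` on the cell
(`setIntegral_sum_cos_mul_sq_eq_zero`, `setIntegral_sum_sin_mul_sq_eq_zero`). No averaging over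
translations and no plane-wave integral is needed: a common translation `u` shifts every phase by
`θ = (2π/L) k·u` (any real `θ` is realised since `k ≠ 0`), so by the translation invariance of `Θ₀`
and the shift invariance of cell integrals of periodic functions (`setIntegral_cellN_comp_add`) the
pairing `θ ↦ ∫_cell (∑ⱼ cos((2π/L) k·xⱼ + θ)) Θ₀²` is constant
(`setIntegral_sum_cos_add_mul_sq_eq`); `θ = π` flips its sign (mean zero) and `θ = -π/2` turns the
cosines into sines.
-/

noncomputable section

open MeasureTheory Filter
open scoped ENNReal NNReal Topology

namespace Summit.AtomisticToContinuum.BoseEinsteinCondensation.Theorems.CorrectorClosure.HealingScaleKacInsertion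

open Literature.MathematicalPhysics.QuantumManyBody.BoseGas

variable {N : ℕ}

/-! ### Covariance of the periodic Feynman–Kac functional under common translations -/

/-- **Covariance of the `[0,∞]`-valued periodic Feynman–Kac functional under a common translation
of all particles** (momentum conservation):
`(e^{-TH} g)(X + (u, …, u)) = (e^{-TH} g(· + (u, …, u)))(X)`. [folklore] -/
theorem periodicFKSemigroup_add_const (v : ℝ → ℝ≥0∞) (L T : ℝ) (g : Config N → ℝ≥0∞)
    (X : Config N) (u : Space) :
    periodicFKSemigroup v L T g (X + fun _ => u) =
      periodicFKSemigroup v L T (fun Y => g (Y + fun _ => u)) X := by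
  simp only [periodicFKSemigroup, periodicFKWeight_add_const, worldLine_add_right]

/-- The same covariance read backwards:
`(e^{-TH} g)(X) = (e^{-TH} g(· - (u, …, u)))(X + (u, …, u))`. [folklore] -/
theorem periodicFKSemigroup_eq_sub_const_add_const (v : ℝ → ℝ≥0∞) (L T : ℝ)
    (g : Config N → ℝ≥0∞) (X : Config N) (u : Space) :
    periodicFKSemigroup v L T g X =
      periodicFKSemigroup v L T (fun Y => g (Y - fun _ => u)) (X + fun _ => u) := by
  rw [periodicFKSemigroup_add_const]
  simp only [add_sub_cancel_right]

/-! ### The translate of a witness is a witness -/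

/-- **The translate `Θ₀ (· + (u, …, u))` of a periodic Feynman–Kac ground state is again one**
(`L > 0`): every field of `IsPeriodicGroundStateFK` is transported by the covariance of the
functional under common translations and the shift invariance of cell integrals of periodic
functions. [folklore] -/
theorem isPeriodicGroundStateFK_comp_add_const {v : ℝ → ℝ≥0∞} {L : ℝ} (hL : 0 < L)
    {Θ₀ : Config N → ℝ} (hΘ : IsPeriodicGroundStateFK v L Θ₀) (u : Space) :
    IsPeriodicGroundStateFK v L fun X => Θ₀ (X + fun _ => u) where
  measurable := hΘ.measurable.comp (measurable_add_const _)
  nonneg X := hΘ.nonneg _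
  periodic X i k := by rw [add_right_comm, hΘ.periodic]
  symm σ X := by
    have h : (X ∘ σ + fun _ => u) = (X + fun _ => u) ∘ σ := by
      funext j; simp only [Pi.add_apply, Function.comp_apply]
    rw [h, hΘ.symm]
  norm_eq := by
    have hper : ∀ (X : Config N) (i : Fin N) (k : Fin 3),
        ENNReal.ofReal (Θ₀ (X + Pi.single i (EuclideanSpace.single k L))) ^ 2 =
          ENNReal.ofReal (Θ₀ X) ^ 2 := fun X i k => by rw [hΘ.periodic]
    rw [lintegral_cellN_comp_add hL (G := fun X => ENNReal.ofReal (Θ₀ X) ^ 2) hper]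
    exact hΘ.norm_eq
  energy_ne_top := hΘ.energy_ne_top
  eigen T hT X := by
    have h := hΘ.eigen T hT (X + fun _ => u)
    rwa [periodicFKSemigroup_add_const] at h
  tendsto g hg hgper hg2 X := by
    -- the back-translated observable `g' = g (· - (u, …, u))`
    have hg'm : Measurable fun Y : Config N => g (Y - fun _ => u) :=
      hg.comp (measurable_sub_const _)
    have hg'per : ∀ (Y : Config N) (i : Fin N) (k : Fin 3),
        g (Y + Pi.single i (EuclideanSpace.single k L) - fun _ => u) = g (Y - fun _ => u) := by
      intro Y i k
      rw [add_sub_right_comm, hgper]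
    have hg'2 : ∫⁻ Y in cellN N L, g (Y - fun _ => u) ^ 2 ≠ ⊤ := by
      have h := lintegral_cellN_comp_add hL (G := fun Y => g Y ^ 2)
        (fun Y i k => by rw [hgper]) (-fun _ => u)
      simp only [← sub_eq_add_neg] at h
      rwa [h]
    -- the pairing: move the translation from `g` onto `Θ₀`
    have hpair : ∫⁻ Y in cellN N L, ENNReal.ofReal (Θ₀ Y) * g (Y - fun _ => u) =
        ∫⁻ Y in cellN N L, ENNReal.ofReal (Θ₀ (Y + fun _ => u)) * g Y := by
      have hGper : ∀ (Y : Config N) (i : Fin N) (k : Fin 3),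
          ENNReal.ofReal (Θ₀ (Y + Pi.single i (EuclideanSpace.single k L))) *
              g (Y + Pi.single i (EuclideanSpace.single k L) - fun _ => u) =
            ENNReal.ofReal (Θ₀ Y) * g (Y - fun _ => u) := fun Y i k => by
        rw [hΘ.periodic, hg'per]
      rw [← lintegral_cellN_comp_add hL
        (G := fun Y => ENNReal.ofReal (Θ₀ Y) * g (Y - fun _ => u)) hGper (fun _ => u)]
      simp only [add_sub_cancel_right]
    have hlim := hΘ.tendsto (fun Y => g (Y - fun _ => u)) hg'm hg'per hg'2 (X + fun _ => u)
    rw [hpair] at hlim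
    refine hlim.congr fun T => ?_
    rw [periodicFKSemigroup_eq_sub_const_add_const v L T g X u]

/-! ### The registered sub-goal -/

/-- **Translation invariance of the torus Feynman–Kac ground state** (`L > 0`, no hypothesis on
`v`): `Θ₀ (X + (u, …, u)) = Θ₀ X`. The translate is again a witness
(`isPeriodicGroundStateFK_comp_add_const`) and witnesses are unique
(`IsPeriodicGroundStateFK.unique`). [folklore] -/
theorem fkGroundState_add_const_eq {v : ℝ → ℝ≥0∞} {L : ℝ} (hL : 0 < L) {Θ₀ : Config N → ℝ}
    (hΘ : IsPeriodicGroundStateFK v L Θ₀) (u : Space) (X : Config N) :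
    Θ₀ (X + fun _ => u) = Θ₀ X :=
  (congrFun (hΘ.unique (isPeriodicGroundStateFK_comp_add_const hL hΘ u)) X).symm

/-- **Sub-goal `fkGroundState_translate_eq` of `stub_kacClosure` (line
`healing-scale-kac-insertion`): the torus Feynman–Kac ground state is invariant under a common
translation of all particles.** For a witness `Θ₀` of `IsPeriodicGroundStateFK v L` (`L > 0`) and
every `u ∈ ℝ³`, `Θ₀ (X + (u, …, u)) = Θ₀ X`: the translate is again a witness (covariance of the
Feynman–Kac functional under common translations, shift invariance of cell integrals of periodic
functions) and witnesses are unique (nondegeneracy of the ground state, encoded in the rank-one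
projection limit of the structure). The measurability of `v` is not used. [folklore] -/
theorem fkGroundState_translate_eq {N : ℕ} {v : ℝ → ℝ≥0∞} (_hv : Measurable v) {L : ℝ}
    (hL : 0 < L) {Θ₀ : Config N → ℝ} (hΘ : IsPeriodicGroundStateFK v L Θ₀) (u : Space)
    (X : Config N) :
    Θ₀ (X + fun _ => u) = Θ₀ X :=
  fkGroundState_add_const_eq hL hΘ u X

/-! ### Corollary: every density mode of `Θ₀²` has vanishing mean (cosine and sine) -/

/-- Phase bookkeeping: a common translation `u` of all particles shifts the phase
`(2π/L) k·xⱼ` of every particle by the same amount `(2π/L) k·u`. [folklore] -/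
theorem fkTranslate_phase_add_const (L : ℝ) (k : Fin 3 → ℤ) (X : Config N) (u : Space)
    (j : Fin N) :
    2 * Real.pi / L * ∑ i, (k i : ℝ) * (X + fun _ => u : Config N) j i =
      2 * Real.pi / L * ∑ i, (k i : ℝ) * X j i + 2 * Real.pi / L * ∑ i, (k i : ℝ) * u i := by
  simp only [Pi.add_apply, PiLp.add_apply, mul_add, Finset.sum_add_distrib]

/-- Periodicity of the density mode `∑ⱼ cos((2π/L) k·xⱼ)` (`k ∈ ℤ³`) under a lattice translation
`L e_{k'}` of one particle: the phase of that particle moves by `2π k_{k'} ∈ 2πℤ`. [folklore] -/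
theorem fkTranslate_sum_cos_add_single {L : ℝ} (hL : L ≠ 0) (k : Fin 3 → ℤ) (X : Config N)
    (i' : Fin N) (k' : Fin 3) :
    ∑ j, Real.cos (2 * Real.pi / L *
        ∑ i, (k i : ℝ) * (X + Pi.single i' (EuclideanSpace.single k' L) : Config N) j i) =
      ∑ j, Real.cos (2 * Real.pi / L * ∑ i, (k i : ℝ) * X j i) := by
  refine Finset.sum_congr rfl fun j _ => ?_
  rw [Pi.add_apply]
  rcases eq_or_ne j i' with rfl | hj
  · rw [Pi.single_eq_same]
    have h : 2 * Real.pi / L * ∑ i, (k i : ℝ) * (X j + EuclideanSpace.single k' L) i =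
        2 * Real.pi / L * ∑ i, (k i : ℝ) * X j i + (k k' : ℝ) * (2 * Real.pi) := by
      simp only [PiLp.add_apply, PiLp.single_apply, mul_add, mul_ite, mul_zero,
        Finset.sum_add_distrib, Finset.sum_ite_eq', Finset.mem_univ, if_true]
      field_simp
    rw [h, Real.cos_add_int_mul_two_pi]
  · rw [Pi.single_eq_of_ne hj, add_zero]

/-- **Phase-shift invariance of the density-mode pairing with `Θ₀²`.** For `k ∈ ℤ³ ∖ {0}` and
every phase `θ`, `∫_cell (∑ⱼ cos((2π/L) k·xⱼ + θ)) Θ₀² = ∫_cell (∑ⱼ cos((2π/L) k·xⱼ)) Θ₀²`: realise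
`θ = (2π/L) k·u` by a translation `u` along a nonzero component of `k`, shift the fundamental cell
by `(u, …, u)` (`setIntegral_cellN_comp_add`, the integrand is periodic) and use the translation
invariance of `Θ₀` (`fkGroundState_add_const_eq`). [folklore] -/
theorem setIntegral_sum_cos_add_mul_sq_eq {v : ℝ → ℝ≥0∞} {L : ℝ} (hL : 0 < L)
    {Θ₀ : Config N → ℝ} (hΘ : IsPeriodicGroundStateFK v L Θ₀) {k : Fin 3 → ℤ} (hk : k ≠ 0)
    (θ : ℝ) :
    ∫ X in cellN N L, (∑ j, Real.cos (2 * Real.pi / L * ∑ i, (k i : ℝ) * X j i + θ)) * Θ₀ X ^ 2 =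
      ∫ X in cellN N L, (∑ j, Real.cos (2 * Real.pi / L * ∑ i, (k i : ℝ) * X j i)) * Θ₀ X ^ 2 := by
  -- a translation `u ∈ ℝ³` realising the phase: `(2π/L) k·u = θ` (`k ≠ 0`)
  obtain ⟨u, hθ⟩ : ∃ u : Space, 2 * Real.pi / L * ∑ i, (k i : ℝ) * u i = θ := by
    obtain ⟨i₀, hi₀⟩ := Function.ne_iff.1 hk
    have hk0 : (k i₀ : ℝ) ≠ 0 := Int.cast_ne_zero.2 hi₀
    refine ⟨EuclideanSpace.single i₀ (θ / (2 * Real.pi / L * k i₀)), ?_⟩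
    simp only [PiLp.single_apply, mul_ite, mul_zero, Finset.sum_ite_eq', Finset.mem_univ,
      if_true]
    field_simp
  -- the integrand is periodic in every particle and axis
  have hper : ∀ (X : Config N) (i' : Fin N) (k' : Fin 3),
      (∑ j, Real.cos (2 * Real.pi / L *
          ∑ i, (k i : ℝ) * (X + Pi.single i' (EuclideanSpace.single k' L) : Config N) j i)) *
        Θ₀ (X + Pi.single i' (EuclideanSpace.single k' L)) ^ 2 =
      (∑ j, Real.cos (2 * Real.pi / L * ∑ i, (k i : ℝ) * X j i)) * Θ₀ X ^ 2 := fun X i' k' => by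
    rw [fkTranslate_sum_cos_add_single hL.ne', hΘ.periodic]
  -- shift the cell by `(u, …, u)` and read off the phases
  rw [← setIntegral_cellN_comp_add hL
    (G := fun X => (∑ j, Real.cos (2 * Real.pi / L * ∑ i, (k i : ℝ) * X j i)) * Θ₀ X ^ 2) hper
    (fun _ => u)]
  congr 1
  funext X
  simp only [fkTranslate_phase_add_const, hθ, fkGroundState_add_const_eq hL hΘ u]

/-- **Every density mode of `Θ₀²` has vanishing mean (cosine part).** For a torus Feynman–Kac
ground state `Θ₀` (`L > 0`) and `k ∈ ℤ³ ∖ {0}`, `∫_cell (∑ⱼ cos((2π/L) k·xⱼ)) Θ₀² = 0`: the phase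
shift `θ = π` flips the sign of the pairing (`setIntegral_sum_cos_add_mul_sq_eq`,
`cos(a + π) = -cos a`). [folklore] -/
theorem setIntegral_sum_cos_mul_sq_eq_zero {v : ℝ → ℝ≥0∞} {L : ℝ} (hL : 0 < L)
    {Θ₀ : Config N → ℝ} (hΘ : IsPeriodicGroundStateFK v L Θ₀) {k : Fin 3 → ℤ} (hk : k ≠ 0) :
    ∫ X in cellN N L, (∑ j, Real.cos (2 * Real.pi / L * ∑ i, (k i : ℝ) * X j i)) * Θ₀ X ^ 2 =
      0 := by
  have h := setIntegral_sum_cos_add_mul_sq_eq hL hΘ hk Real.pi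
  simp only [Real.cos_add_pi, Finset.sum_neg_distrib, neg_mul, integral_neg] at h
  linarith

/-- **Every density mode of `Θ₀²` has vanishing mean (sine part).** For a torus Feynman–Kac ground
state `Θ₀` (`L > 0`) and `k ∈ ℤ³ ∖ {0}`, `∫_cell (∑ⱼ sin((2π/L) k·xⱼ)) Θ₀² = 0`: the phase shift
`θ = -π/2` turns cosines into sines (`cos(a - π/2) = sin a`), and the cosine mean vanishes.
[folklore] -/
theorem setIntegral_sum_sin_mul_sq_eq_zero {v : ℝ → ℝ≥0∞} {L : ℝ} (hL : 0 < L)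
    {Θ₀ : Config N → ℝ} (hΘ : IsPeriodicGroundStateFK v L Θ₀) {k : Fin 3 → ℤ} (hk : k ≠ 0) :
    ∫ X in cellN N L, (∑ j, Real.sin (2 * Real.pi / L * ∑ i, (k i : ℝ) * X j i)) * Θ₀ X ^ 2 =
      0 := by
  have h := setIntegral_sum_cos_add_mul_sq_eq hL hΘ hk (-(Real.pi / 2))
  simp only [← sub_eq_add_neg, Real.cos_sub_pi_div_two] at h
  rw [h]
  exact setIntegral_sum_cos_mul_sq_eq_zero hL hΘ hk

end Summit.AtomisticToContinuum.BoseEinsteinCondensation.Theorems.CorrectorClosure.HealingScaleKacInsertion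

end
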